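import Literature.Claims.NS.ClayVariants
import Literature.Claims.NS.ClayPeriodScalingBridge
import Literature.Claims.NS.ClayPeriodicSupBlowupCertificate
import Literature.Analysis.FluidPDE.GeneralizedAxisymNS
import HarnessLib

/-!
# Claim skeleton (D-0090 NS-CLAIMS, C12): Shahmurov (2026), «Stable Finite-Time Singularity Formation
# for 3D Navier–Stokes via 5D-Lifted Axisymmetric Reductions»

Cell `ns-claims`, claim C12, typist `ns-claims-typist-8` (refuter `ns-claims-refuter-4`, referee
`ns-claims-ref-3`, sources `ns-claims-lit-2`). UNREFEREED CLAIM under adjudication — NOTHING in this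
file asserts a step of the paper: the claimed theorem and every step are `def … : Prop`; the only
`theorem`s are kernel COMPOSITIONS of the paper's own implications, pure arithmetic on the printed
constants, and the comparison with the tree's Clay statements (`Literature.Claims.NS.ClayVariants`).

Version of record: R. Shahmurov, arXiv:2604.09949v1 [math.AP], 10 Apr 2026, 14 pp. (only version; no
ancillary files) [Shahmurov2026b]. Locators «p. N» = PDF page, «l. N» = line of the e-print TeX
`Son.tex`; materialised in `run/shared/lean/pub/ns-claims/sources/Shahmurov2026b/` (LOCATORS.md by
ns-claims-lit-2). (The same author's REGULARITY claims of May–June 2026 are the separate claim C11.)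

## Claimed statement (as printed, Thm 2.1, p. 2, l. 71–89)

«Let ν ∈ (0, ν_c), where ν_c ≈ 0.00582. Then there exists an initial velocity field u₀ ∈ C^∞(𝕋³) such
that ∇·u₀ = 0, ∫_{𝕋³}|u₀(x)|² dx < ∞, and the unique solution u(x,t) of the three-dimensional
incompressible Navier–Stokes equations ∂ₜu + (u·∇)u + ∇p = νΔu, ∇·u = 0, x ∈ 𝕋³ (2.1) develops a
finite-time singularity at some time T* < ∞. More precisely, ∫₀^{T*} ‖∇u(·,t)‖_{L^∞} dt = ∞ (2.2).
The blow-up is asymptotically nearly self-similar and stable in the analytically weighted space 𝒳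
introduced below.» Here 𝕋³ = ℝ³/2πℤ³ (lattice images `x + 2πn`, (13.1) p. 10, l. 575, 608).
Typed: `ClaimedTheorem` — for every `ν ∈ (0, nuC)` a `C^∞`, divergence-free, `2πℤ³`-periodic datum on
`ℝ³`, square-integrable over a period cell, and a classical solution `(u, p)` on `ℝ³ × [0, T*)`,
`0 < T* < ∞`, with `u(·,t)`, `p(·,t)` `2π`-periodic, `u(0) = u₀`, whose gradient has
`∫₀^{T*} ‖∇u(t)‖_{L^∞} dt = ∞` (lower Lebesgue integral of the `ℝ≥0∞`-valued supremum: no junk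
value, TYPING-HYGIENE §1–§2). «The unique solution» is a definite description, read as the classical
solution with periodic velocity AND pressure — the class the construction produces (Lemma 13.1 /
Thm 13.2 (ii) speak of «the periodic pressure», p. 10) and in which smooth solutions are unique; no
separate uniqueness conjunct is typed. The rider «asymptotically nearly self-similar and stable in 𝒳»
has no printed definition (𝒳 itself is specified only through an unspecified eigenbasis, Def 5.1
p. 4) and is NOT typed; CARD §2 records it.

## Clay delta (reference `ClayVariants.lean`; nearest statement: printed (D), hence errata (D))

Direction BLOW-UP, periodic, unforced. Axes: Δ1 domain = `2π`-torus (period `2π` vs `1`: EQUIVALENT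
by the parabolic scaling `u ↦ λu(λ²t, λx)`, `λ = 2π`, which keeps `ν` — Tao 2013 Rem. 1.2 — but the
scaling of CLASSICAL periodic solutions is not in `Literature/`: typed bridge `PeriodScalingBridge`) ·
Δ2 equations = · Δ3 force ≡ 0 = · Δ4 datum `C^∞` periodic = (8) · Δ5/Δ6 conclusion = finite-time loss
of smoothness of THE periodic-pressure solution from one datum, i.e. `¬`(B)-type at that datum: to
exclude EVERY global smooth solution of the printed class (10) (velocity periodic, pressure free) one
needs the continuation/uniqueness bridge «a periodic classical solution on `[0,T*)` with
`∫₀^{T*}‖∇u‖_∞ = ∞` excludes a global smooth printed-class solution from the same datum» (classical: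
uniqueness of smooth periodic solutions up to the Galilean frame freedom of `NSWave0`'s docstring,
which leaves `‖∇u(t)‖_∞` invariant; not in the tree): typed bridge `ContinuationBridge` · Δ7 `ν`
restricted to `(0, ν_c)`: NOT a delta for an unforced periodic counterexample — one viscosity gives
printed (D) at every viscosity (`ClayVariants.navierStokesBreakdownPeriodic_of_not_regularityAt`, in
tree) · Δ8 pressure periodicity: the constructed pressure is claimed periodic (p. 10), so the errata
leaf follows from the printed one (`clayPeriodic_breakdown_imp_errata`).
`ClayDelta := ContinuationBridge ∧ PeriodScalingBridge` (two CLASSICAL bridges, no wrong-problem axis);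
`clay_of_claimed_of_delta : ClayDelta → ClaimedTheorem → ClayVariants.clayPeriodic.Breakdown` is
PROVED. So IF Steps 1–6 held, the claim would prove Clay (D) modulo two classical lemmas — reported
to the lead as escalation-grade bookkeeping, not as a finding.

## Steps (dependency order of the proof of Thm 2.1, §14 p. 11, l. 642–647; ties by print order)

* Step 1 = `Step_1` **S-LIFT** (§3 Def 3.1 + (3.1)–(3.3) p. 2; Def 4.1 (4.1)–(4.2) pp. 2–3; Def 4.3
  (4.4)–(4.6) p. 3; consumed by Thm 12.1 p. 9 «induces a three-dimensional velocity field (12.2)»,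
  proof: «Therefore the reconstructed field solves the lifted evolution», and by §14 «yields a
  finite-time singular evolution»): every smooth solution `(Ω̄, ψ̄)` of the PRINTED stationary profile
  system — (4.2) with the drift `ū^ρ = −ρ⁻³∂_ζψ̄`, `ū^ζ = ρ⁻³∂_ρψ̄` of (4.5) and the recovery law
  (4.4) `ℬ(ψ̄/ρ⁴) = ∂_ζ(Ω̄²)` — whose reconstructed field `ū = ū^ρ e_ρ + ρΩ̄ e_θ + ū^ζ e_z` (the map
  `(Ω, b) ↦ u` is never displayed; this is the reading fixed by Def 3.1 `Ω = u^θ/r`, `b = (u^r, u^z)`,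
  FAILURE-MODES F17 «natural reconstruction») is smooth on `ℝ³`, yields by (12.2)
  `u(x,t) = (T*−t)^{−1/2} ū(x/√(T*−t))` a CLASSICAL NAVIER–STOKES SOLUTION (some pressure) on
  `ℝ³ × (0,T*)` — in particular `∇·u = 0` of (2.1). Hypotheses = what the proof of Thm 12.1 uses
  (pointwise substitution; no decay, no membership in 𝒳), as asked by refuter-4/ref-3 (INBOX
  16:30Z, RETYPE §2 R#a). Typist's flag: known-false pattern — for an axisymmetric field
  `div u = ∂ᵣu^r + u^r/r + ∂_zu^z`, so the printed 5D constraint (3.3)/(4.6) equals `div u + 2u^r/r = 0`;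
  the drift (4.5) is Hou's real-dimension-`n = 5` drift (`GeneralizedAxisymNS.radialVel`,
  `axialVel 5` of `W = ψ̄/ρ⁴`) while ℬ (3.1) is his `n = 3` operator `GeneralizedAxisymNS.lap 3`, and
  the recovery law (4.4) replaces the parabolic `ω^θ/r`-equation of axisymmetric Navier–Stokes
  (tree: `GeneralizedAxisymNS.vorticity_eq`/`stream_eq` at `n = 3`) by an algebraic slaving.
  CHARITABLE VARIANT `Step_1'` (same conclusion over the smaller class `IsExactProfile`: adds §4.3
  p. 4 oddness/decay, Prop 4.4 p. 3–4 `W = O(ρ²)` at the axis and decay of `W`, and non-triviality);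
  `Step_1 → Step_1'` (`step1'_of_step1`), and the composition is proved from `Step_1'` already
  (`claim_of_steps'`), so a referee's re-typing to the profile class is pre-wired.
* Step 2 = `Step_2` **S-CAP** (ONE step, per ASSIGNMENTS: Def 5.1/Rem 5.2 p. 4, Def 7.1 p. 5, Lemma 8.1
  (8.1) `δ = 8.421739·10⁻¹²` pp. 5–6, Lemma 9.1/Thm 9.2 `M = 482.6` pp. 6–7, Lemma 10.1/Prop 10.2/
  Lemma 10.3 `K = 1.1·10⁴` pp. 7–8, Cor 10.4 `2δMK ≈ 8.9·10⁻⁵ < 1` p. 8, App. A–D pp. 11–13): for every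
  `ν ∈ (0, ν_c)` there are Banach spaces 𝒴, 𝒳 and an ANALYTIC PROFILE FRAMEWORK (`Framework ν Y X`: the
  profile operator as a map `G : 𝒴 → 𝒳`, the approximate profile, and realisation maps under which
  `G` IS formula (4.1) with the recovery (4.4)–(4.5) on the open half-plane and elements of 𝒴 are
  smooth, odd, decaying profiles with smooth reconstructed fields — the abstract carrier of F1, since
  the basis `{Φⱼ}` = «the actual eigenfunctions of the compactified lifted operator on S⁴» is not
  specified in print) in which the printed ENCLOSURES hold: `‖G(Ω̄_app)‖ ≤ δ`, `DG(Ω̄_app)` invertible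
  with `‖DG(Ω̄_app)⁻¹‖ ≤ M`, `‖DG(u) − DG(v)‖ ≤ K‖u − v‖`, and `‖Ω̄_app‖ > 2Mδ` (App. A: `Ω̂₁ = 5`).
  The closure inequality itself is arithmetic and PROVED (`nk_closure`, `torus_closure`; also the
  Kantorovich form `2δM²K ≤ 1`, `kantorovich_closure`). The range `(0, ν_c)` enters the paper only at
  l. 72 (the audit log, App. B p. 12, shows one run at `nu = 0.005`); typing the enclosures for every
  `ν` in the range is the only way Thm 2.1 can use §8–§11. Typist's flag: not reproducible from print
  (no code/data in the e-print; App. E–F p. 13–14: «previously uploaded files expired», «a complete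
  referee-grade release should additionally provide …»).
* Step 3 = `Step_3` **S-PROFILE = Thm 11.1** (pp. 8–9, l. 498–519: «the Newton–Kantorovich theorem
  applies and yields a unique exact zero … in the validated ball around Ω̄_app»): in ANY framework,
  the enclosures with the PRINTED constants yield a zero `Ω̄` of `G` with `‖Ω̄ − Ω̄_app‖ ≤ 2Mδ`. Typist's
  flag: true (classical Newton–Kantorovich, whose hypothesis `2δM²K ≤ 1` holds for the printed
  constants: `kantorovich_closure`). The PRINTED inference of Cor 10.4, «2δMK < 1, hence the
  Newton–Kantorovich condition is satisfied», read for arbitrary constants, is the support decl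
  `CorNKInference` (FAILURE-MODES F15; known-false pattern: `G(x) = δ' + x/M' + K'x²/2` on `ℝ` has
  no zero when `2δ'M'²K' > 1 ≥ 2δ'M'K'`); it is NOT on the path (MAP-SCHEMA §1b: erratum column).
* Step 4 = `Step_4` **S-RECON = Thm 12.1 as printed** ((12.1)–(12.4), p. 9): for the reconstructed
  field of an exact profile, `ω(x,t) = (T*−t)⁻¹ ω̄(x/√(T*−t))` (12.3),
  `‖ω(t)‖_∞ = (T*−t)⁻¹‖ω̄‖_∞` (12.4) and `∫₀^{T*}‖ω(t)‖_∞ dt = ∞`. Typist's flag: true (chain rule;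
  the implicit «Ω̄ ≢ 0 ⇒ ω̄ ≢ 0» holds for smooth fields with non-zero swirl).
* Step 5 = `Step_5` **S-TORUS-DATA = Lemma 13.1 + Thm 13.2 (13.1), (i)** (p. 10, l. 556–615): for the
  profile `ū` the lattice sums `Σₙ ū(x + 2πn)` converge («Gaussian-localized core», l. 586) and the
  Leray-projected periodisation `u₀ = 𝒫 Σₙ ū(· + 2πn)` is a `C^∞`, `2π`-periodic, divergence-free field
  within `10⁻²⁰` of the periodisation. Typed existentially (no Leray projector on `2π`-periodic fields
  in the tree). Typist's flag: suspicious (an exactly self-similar profile giving (12.4) with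
  `ω̄ ∈ L^∞` is not Gaussian-localized unless trivial; no decay of `ū` is printed).
* Step 6 = `Step_6` **S-PERSIST = Thm 13.2 (iii) + «Consequently, the singularity persists on 𝕋³»**
  (p. 10–11, l. 620–640; §14 l. 645 «transfers to an exactly divergence-free periodic initial field on
  𝕋³ while preserving the validated Newton–Kantorovich margin»), typed as the implication the headline
  consumes («implicit» evolution claim): the singular self-similar Navier–Stokes evolution on `ℝ³`
  with profile `ū` (outputs of Steps 1, 4), the datum `u₀` of Step 5 and the inequality
  `2(δ + ε_𝕋³)MK < 1` imply that the periodic Cauchy problem from `u₀` has a classical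
  periodic-pressure solution on some `[0, T')` with `∫₀^{T'}‖∇u‖_∞ = ∞`. Typist's flag: suspicious
  (no stability theorem for the EVOLUTION is printed; a stationary certificate is transferred).
Ordered index (TYPING-HYGIENE 11): Step 1 = `Step_1` (pp. 2–3, used p. 9) · Step 2 = `Step_2`
(pp. 4–8) · Step 3 = `Step_3` (pp. 8–9) · Step 4 = `Step_4` (p. 9) · Step 5 = `Step_5` (p. 10) ·
Step 6 = `Step_6` (pp. 10–11).
Support decls (not on the path): `LiftedIncompressibility` = (3.3) p. 2 as printed for axisymmetric
divergence-free fields (forward direction of the reduction; erratum column), `CorNKInference` (above),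
`Step_1'` (charitable class).

## COMPOSITION — proved as `claim_of_steps`

`claim_of_steps : Step_1 → Step_2 → Step_3 → Step_4 → Step_5 → Step_6 → ClaimedTheorem` and
`claim_of_steps' : Step_1' → Step_2 → … → Step_6 → ClaimedTheorem` — PROVED (pure logic + the glue
`exactProfile_of_zero`: a zero within `2Mδ` of `Ω̄_app` with `‖Ω̄_app‖ > 2Mδ` is non-zero, hence its
realisation is a non-trivial profile; + `integrableOn_periodCell` for the printed energy clause).
The paper's logic composes AS TYPED; the located weaknesses are INSIDE Steps 1, 2, 5, 6 (flags above),
not between them.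

WHAT THIS IS NOT: not a claim about NS regularity or blow-up; not a claim about any author beyond the
typed locator.
-/

noncomputable section

open Set Function MeasureTheory Filter
open scoped ContDiff ENNReal Topology

namespace Literature.Claims.NS.Shahmurov2026b

open Literature.Analysis.FluidPDE

/-! ## Printed constants (App. D «Constant-closure table», p. 13, l. 705–723) -/

/-- `ν_c ≈ 0.00582`, the viscosity threshold of Thm 2.1 (its only occurrence in the paper, l. 72);
typed as the printed decimal. [cite: Shahmurov2026b, Thm 2.1 p.2] -/
def nuC : ℝ := 0.00582

/-- `δ = 8.421739 × 10⁻¹²`, the residual enclosure (8.1). [cite: Shahmurov2026b, Lemma 8.1 eq. (8.1) p.5] -/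
def residualDelta : ℝ := 8.421739e-12

/-- `M = 482.6`, the inverse stability bound (9.x). [cite: Shahmurov2026b, Thm 9.2 p.7] -/
def inverseBoundM : ℝ := 482.6

/-- `K = 1.1 × 10⁴`, the local Lipschitz constant (10.x). [cite: Shahmurov2026b, Lemma 10.3 p.8] -/
def lipschitzK : ℝ := 1.1e4

/-- `ε_𝕋³ ≤ 1.42 × 10⁻²⁰`, the torus transfer error. [cite: Shahmurov2026b, Lemma 13.1 p.10] -/
def torusEps : ℝ := 1.42e-20

/-- `0 < ν_c`. [cite: Shahmurov2026b, Thm 2.1 p.2] -/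
theorem nuC_pos : 0 < nuC := by norm_num [nuC]

/-- **Cor 10.4 as arithmetic**: `2δMK < 1` for the printed constants (`≈ 8.9 × 10⁻⁵`). This part of
the certificate is kernel-checked here; the content of the CAP lies in the enclosures `δ, M, K`
themselves (`Step_2`). [cite: Shahmurov2026b, Cor 10.4 p.8] -/
theorem nk_closure : 2 * residualDelta * inverseBoundM * lipschitzK < 1 := by
  norm_num [residualDelta, inverseBoundM, lipschitzK]

/-- **Thm 13.2 (iii) as arithmetic**: `2(δ + ε_𝕋³)MK < 1`. [cite: Shahmurov2026b, Thm 13.2 (iii) p.10] -/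
theorem torus_closure : 2 * (residualDelta + torusEps) * inverseBoundM * lipschitzK < 1 := by
  norm_num [residualDelta, inverseBoundM, lipschitzK, torusEps]

/-- The hypothesis the Newton–Kantorovich theorem actually needs, `h = (Mδ)(MK) ≤ ½`, i.e.
`2δM²K ≤ 1` (`≈ 0.043`), ALSO holds for the printed constants — so the printed slip `2δMK` vs `2δM²K`
(support decl `CorNKInference`) is not load-bearing. [cite: Shahmurov2026b, Cor 10.4 p.8] -/
theorem kantorovich_closure : 2 * residualDelta * inverseBoundM ^ 2 * lipschitzK ≤ 1 := by
  norm_num [residualDelta, inverseBoundM, lipschitzK]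

/-! ## The printed lifted / profile system (§3–§4) over meridian profiles `q = (ρ, ζ) ∈ ℝ × ℝ`

Partial derivatives `derivR = ∂_ρ`, `derivZ = ∂_ζ` and Hou's operator
`GeneralizedAxisymNS.lap n = ∂_ρρ + (n/ρ)∂_ρ + ∂_ζζ` are the tree's (`GeneralizedAxisymNS.lean`); the
paper's ℬ (3.1) is `lap 3`. Values at `ρ ≤ 0` are never constrained (the equations are imposed on the
open half-plane `0 < ρ`). -/

/-- The radial drift of (4.5): `ū^ρ = −ρ⁻³ ∂_ζψ̄`. [cite: Shahmurov2026b, Def 4.3 eq. (4.5) p.3] -/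
def driftR (ψ : ℝ × ℝ → ℝ) (q : ℝ × ℝ) : ℝ :=
  -((q.1 ^ 3)⁻¹ * derivZ ψ q)

/-- The axial drift of (4.5): `ū^ζ = ρ⁻³ ∂_ρψ̄`. [cite: Shahmurov2026b, Def 4.3 eq. (4.5) p.3] -/
def driftZ (ψ : ℝ × ℝ → ℝ) (q : ℝ × ℝ) : ℝ :=
  (q.1 ^ 3)⁻¹ * derivR ψ q

/-- `W = ψ̄/ρ⁴`, the argument of ℬ in the recovery law (4.4) (Prop 4.4: «if W = ψ̄/ρ⁴ solves (4.4)»).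
[cite: Shahmurov2026b, Def 4.3 eq. (4.4) and Prop 4.4 p.3] -/
def streamW (ψ : ℝ × ℝ → ℝ) (q : ℝ × ℝ) : ℝ :=
  ψ q / q.1 ^ 4

/-- The recovery law (4.4) at the point `q`: `ℬ(ψ̄/ρ⁴) = ℱ(Ω̄) = ∂_ζ(Ω̄²)`, ℬ = `lap 3` (3.1).
[cite: Shahmurov2026b, Def 4.3 eq. (4.4) p.3] -/
def RecoveryLaw (Ω ψ : ℝ × ℝ → ℝ) (q : ℝ × ℝ) : Prop :=
  GeneralizedAxisymNS.lap 3 (streamW ψ) q = derivZ (fun q' => Ω q' ^ 2) q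

/-- The stationary profile operator (4.1) at `q = (ρ, ζ)`, with `b̄ = (ū^ρ, ū^ζ)` recovered from `ψ̄`
by (4.5): `𝒢(Ω̄,ν) = Ω̄ + ½(ρ∂_ρ + ζ∂_ζ)Ω̄ + b̄·∇Ω̄ − ν(∂_ρρ + (3/ρ)∂_ρ + ∂_ζζ)Ω̄ + 2(ū^ρ/ρ)Ω̄`.
[cite: Shahmurov2026b, Def 4.1 eq. (4.1) pp.2–3] -/
def profileOp (ν : ℝ) (Ω ψ : ℝ × ℝ → ℝ) (q : ℝ × ℝ) : ℝ :=
  Ω q + (1 / 2) * (q.1 * derivR Ω q + q.2 * derivZ Ω q) +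
    (driftR ψ q * derivR Ω q + driftZ ψ q * derivZ Ω q) -
    ν * GeneralizedAxisymNS.lap 3 Ω q + 2 * (driftR ψ q / q.1) * Ω q

/-- A SOLUTION OF THE PRINTED STATIONARY PROFILE SYSTEM (what the substitution argument of Thm 12.1
uses, nothing more): `Ω̄`, `ψ̄` smooth (here: `C^∞` on `ℝ²`, a harmless narrowing of «smooth on the
half-plane»), the profile equation `𝒢(Ω̄,ν) = 0` (4.2) and the recovery law (4.4) on the open
half-plane `0 < ρ`, the drift being (4.5) by construction of `profileOp`. No oddness, decay or axis
behaviour (those enter `IsExactProfile`). [cite: Shahmurov2026b, Def 4.1 (4.1)–(4.2) pp.2–3 and Def 4.3 (4.4)–(4.6) p.3] -/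
structure IsProfilePair (ν : ℝ) (Ω ψ : ℝ × ℝ → ℝ) : Prop where
  /-- `Ω̄ ∈ C^∞`. -/
  smooth_Ω : ContDiff ℝ ∞ Ω
  /-- `ψ̄ ∈ C^∞`. -/
  smooth_ψ : ContDiff ℝ ∞ ψ
  /-- (4.2) on `0 < ρ`. -/
  profile_eq : ∀ q : ℝ × ℝ, 0 < q.1 → profileOp ν Ω ψ q = 0
  /-- (4.4) on `0 < ρ`. -/
  recovery : ∀ q : ℝ × ℝ, 0 < q.1 → RecoveryLaw Ω ψ q

/-! ## The reconstruction (12.1)–(12.2) (Def 3.1: `Ω = u^θ/r`, `b = (u^r, u^z)`; F17 natural map) -/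

/-- The 3D field of a meridian triple off the axis: `ū(y) = ū^ρ e_ρ + ρΩ̄ e_θ + ū^ζ e_z` at `y`,
`(ρ, ζ) = meridian y = (cylRadius y, y₂)`, in the tree's cylindrical frame `eR, eTheta, eZ` (so that
`u^θ/ρ = Ω̄`, Def 3.1, and `(u^r, u^z)` is the drift (4.5)). On the axis the value is junk (the frame
vectors vanish there); statements use a smooth field agreeing with it OFF the axis.
[cite: Shahmurov2026b, Def 3.1 p.2 and Thm 12.1 eq. (12.2) p.9] -/
def reconstruct (Ω ψ : ℝ × ℝ → ℝ) (y : EuclideanSpace ℝ (Fin 3)) : EuclideanSpace ℝ (Fin 3) :=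
  driftR ψ (meridian y) • eR y + (cylRadius y * Ω (meridian y)) • eTheta y + driftZ ψ (meridian y) • eZ

/-- The exactly self-similar field (12.2): `u(x,t) = (T*−t)^{−1/2} ū(x/√(T*−t))` (junk `0` for
`t ≥ T*`, never used). [cite: Shahmurov2026b, Thm 12.1 eq. (12.2) p.9] -/
def selfSimilar (T : ℝ) (ubar : EuclideanSpace ℝ (Fin 3) → EuclideanSpace ℝ (Fin 3)) (t : ℝ)
    (x : EuclideanSpace ℝ (Fin 3)) : EuclideanSpace ℝ (Fin 3) :=
  (Real.sqrt (T - t))⁻¹ • ubar ((Real.sqrt (T - t))⁻¹ • x)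

/-- AN EXACT STATIONARY PROFILE WITH ITS RECONSTRUCTED FIELD — the output of Thm 11.1 as the later
sections use it: a solution of the printed system (`IsProfilePair`) which in addition is odd in `ζ`
and decays (§4.3, p. 4: «Ω̄(ρ,ζ) = −Ω̄(ρ,−ζ), regularity at the axis ρ = 0, and decay as
ρ² + ζ² → ∞»), whose `W = ψ̄/ρ⁴` is `O(ρ²)` at the axis and decays (Prop 4.4 proof, p. 4: «W = O(ρ²)
near the axis … the outer terms vanish by the Gevrey decay of the profile»), whose reconstructed field
is smooth across the axis («regularity at the axis»), and which is non-trivial (Thm 11.1: the zero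
lies «in a neighborhood of Ω̄_app», App. A: `Ω̂₁ = 5`). [cite: Shahmurov2026b, §4.3 p.4, Prop 4.4 pp.3–4, Thm 11.1 pp.8–9] -/
structure IsExactProfile (ν : ℝ) (Ω ψ : ℝ × ℝ → ℝ)
    (ubar : EuclideanSpace ℝ (Fin 3) → EuclideanSpace ℝ (Fin 3)) : Prop where
  /-- (4.2) and (4.4) with the drift (4.5), smooth unknowns. -/
  pair : IsProfilePair ν Ω ψ
  /-- §4.3: `Ω̄` odd in `ζ`. -/
  odd : ∀ ρ ζ : ℝ, Ω (ρ, -ζ) = -Ω (ρ, ζ)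
  /-- §4.3: `Ω̄ → 0` as `ρ² + ζ² → ∞` (on the half-plane). -/
  decay : ∀ ε : ℝ, 0 < ε → ∃ R : ℝ, ∀ q : ℝ × ℝ, 0 < q.1 → R ≤ ‖q‖ → |Ω q| < ε
  /-- Prop 4.4: `W = O(ρ²)` near the axis, locally uniformly in `ζ`. -/
  stream_axis : ∀ R : ℝ, ∃ C : ℝ, ∀ q : ℝ × ℝ, 0 < q.1 → q.1 ≤ 1 → |q.2| ≤ R →
    |streamW ψ q| ≤ C * q.1 ^ 2
  /-- Prop 4.4: `W → 0` at infinity (on the half-plane). -/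
  stream_decay : ∀ ε : ℝ, 0 < ε → ∃ R : ℝ, ∀ q : ℝ × ℝ, 0 < q.1 → R ≤ ‖q‖ → |streamW ψ q| < ε
  /-- §4.3 «regularity at the axis»: the reconstructed field is `C^∞` on `ℝ³` … -/
  field_smooth : ContDiff ℝ ∞ ubar
  /-- … and IS the reconstruction (12.2)/Def 3.1 off the axis. -/
  field_eq : ∀ y : EuclideanSpace ℝ (Fin 3), cylRadius y ≠ 0 → ubar y = reconstruct Ω ψ y
  /-- Thm 11.1 + App. A: the profile is not identically zero on the half-plane. -/
  nontrivial : ∃ q : ℝ × ℝ, 0 < q.1 ∧ Ω q ≠ 0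

/-! ## Step 1 — S-LIFT -/

/-- **Step 1 (S-LIFT, literal class): a solution of the printed lifted/profile system reconstructs to a
Navier–Stokes solution.** For every `ν > 0`, `T* > 0`, every solution `(Ω̄, ψ̄)` of the printed
stationary system (`IsProfilePair`: (4.2) with drift (4.5), recovery (4.4), on `0 < ρ`) and every
`C^∞` field `ū` on `ℝ³` that equals the reconstruction `ū^ρ e_ρ + ρΩ̄ e_θ + ū^ζ e_z` off the axis, the
self-similar field `u(x,t) = (T*−t)^{−1/2}ū(x/√(T*−t))` (12.2) is, with some pressure, a CLASSICAL
solution of the Navier–Stokes system (2.1) (viscosity `ν`, no force) on `ℝ³ × (0, T*)` — including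
`∇·u = 0`. This is the identification «lifted system = axisymmetric Navier–Stokes in new variables»
of §3 (Def 3.1, (3.2), and (3.3) «the meridional drift satisfies the 5D incompressibility condition
∂ᵣu^r + (3/r)u^r + ∂_zu^z = 0») in the direction Thm 12.1 uses it («the reconstructed field solves the
lifted evolution» ⇒ «singular solution»). Typist's flag: known-false pattern (3D divergence of the
reconstruction is `−2ū^ρ/ρ`). [cite: Shahmurov2026b, Def 3.1 (3.1)–(3.3) p.2, Def 4.3 (4.4)–(4.6) p.3, Thm 12.1 p.9] -/
def Step_1 : Prop :=
  ∀ ν : ℝ, 0 < ν → ∀ T : ℝ, 0 < T →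
    ∀ (Ω ψ : ℝ × ℝ → ℝ) (ubar : EuclideanSpace ℝ (Fin 3) → EuclideanSpace ℝ (Fin 3)),
      IsProfilePair ν Ω ψ → ContDiff ℝ ∞ ubar →
      (∀ y : EuclideanSpace ℝ (Fin 3), cylRadius y ≠ 0 → ubar y = reconstruct Ω ψ y) →
        ∃ p : ℝ → EuclideanSpace ℝ (Fin 3) → ℝ,
          IsClassicalNSSolutionOn (Ioo 0 T) ν 0 (selfSimilar T ubar) p

/-- **Step 1′ (S-LIFT, charitable profile class)**: the same identification asserted only for EXACT
PROFILES (`IsExactProfile`: adds the oddness/decay of §4.3, the axis behaviour `W = O(ρ²)` and decay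
of `W` of Prop 4.4, and non-triviality). `Step_1 → Step_1'` (`step1'_of_step1`); the composition
`claim_of_steps'` needs only this weaker form. [cite: Shahmurov2026b, Thm 12.1 p.9 with §4.3 p.4 and Prop 4.4 pp.3–4] -/
def Step_1' : Prop :=
  ∀ ν : ℝ, 0 < ν → ∀ T : ℝ, 0 < T →
    ∀ (Ω ψ : ℝ × ℝ → ℝ) (ubar : EuclideanSpace ℝ (Fin 3) → EuclideanSpace ℝ (Fin 3)),
      IsExactProfile ν Ω ψ ubar →
        ∃ p : ℝ → EuclideanSpace ℝ (Fin 3) → ℝ,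
          IsClassicalNSSolutionOn (Ioo 0 T) ν 0 (selfSimilar T ubar) p

/-- `Step_1 → Step_1'` (the exact-profile class is contained in the literal class). [cite: Shahmurov2026b, Thm 12.1 p.9] -/
theorem step1'_of_step1 (h : Step_1) : Step_1' :=
  fun ν hν T hT Ω ψ ubar hP => h ν hν T hT Ω ψ ubar hP.pair hP.field_smooth hP.field_eq

/-! ## Step 2 — S-CAP (the analytic framework and the printed enclosures) -/

/-- **The analytic profile framework at viscosity `ν` over Banach spaces `𝒴`, `𝒳`** (Def 5.1 /
Rem 5.2 p. 4, Def 7.1 p. 5, App. C p. 13) — the abstract carrier with exactly the structure the proof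
of Thm 11.1 and the later sections use: `𝒴` (source, norm (5.2)) and `𝒳` (target, norm (5.1)) are
ARBITRARY real normed spaces (parameters; completeness is asked where the steps quantify); the profile
operator `𝒢(·, ν)` is a map `G : 𝒴 → 𝒳`; `Ωapp` is the approximate profile `Ω̄_app`; and the
REALISATION maps — `profile` (the synthesis `Ω = Σ Ω̂ⱼΦⱼ` as a meridian function), `stream` (the
streamfunction `ψ̄` of (4.4), «exact spectral inversion of ℬ», App. C), `field` (the reconstructed 3D
field, smooth across the axis: the `Φⱼ` live in the «axisymmetric, odd-in-ζ, co-exact divergence-free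
sector» on `S⁴`) and `target` (realisation of residuals) — make `G` FORMULA (4.1) on `0 < ρ` and every
element of `𝒴` an odd, decaying, axis-regular profile. The basis `{Φⱼ}` («the actual eigenfunctions
of the compactified lifted operator on S⁴») is not specified in print; nothing here fixes it.
[cite: Shahmurov2026b, Def 5.1 and Remark 5.2 p.4, Def 4.1 p.2, Def 4.3 p.3, App. C p.13] -/
structure Framework (ν : ℝ) (Y X : Type) [NormedAddCommGroup Y] [NormedSpace ℝ Y]
    [NormedAddCommGroup X] [NormedSpace ℝ X] where
  /-- The profile operator `𝒢(·, ν) : 𝒴 → 𝒳`. -/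
  G : Y → X
  /-- The approximate profile `Ω̄_app` (Def 7.1). -/
  Ωapp : Y
  /-- Synthesis: an element of `𝒴` as a meridian profile `Ω̄(ρ, ζ)`. -/
  profile : Y → ℝ × ℝ → ℝ
  /-- The streamfunction `ψ̄` attached to an element by the recovery law (4.4). -/
  stream : Y → ℝ × ℝ → ℝ
  /-- The reconstructed 3D field `ū` of an element. -/
  field : Y → EuclideanSpace ℝ (Fin 3) → EuclideanSpace ℝ (Fin 3)
  /-- Realisation of elements of `𝒳` (residuals) as meridian functions. -/
  target : X → ℝ × ℝ → ℝ
  /-- The zero residual is the zero function. -/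
  target_zero : target 0 = fun _ => 0
  /-- `G` IS the printed formula (4.1) (with (4.5)) on the open half-plane. -/
  G_eq : ∀ (y : Y) (q : ℝ × ℝ), 0 < q.1 → target (G y) q = profileOp ν (profile y) (stream y) q
  /-- Profiles are smooth. -/
  profile_smooth : ∀ y : Y, ContDiff ℝ ∞ (profile y)
  /-- Streamfunctions are smooth. -/
  stream_smooth : ∀ y : Y, ContDiff ℝ ∞ (stream y)
  /-- (4.4) holds for every element. -/
  recovery : ∀ (y : Y) (q : ℝ × ℝ), 0 < q.1 → RecoveryLaw (profile y) (stream y) q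
  /-- Def 5.1: odd-in-`ζ` sector. -/
  profile_odd : ∀ (y : Y) (ρ ζ : ℝ), profile y (ρ, -ζ) = -profile y (ρ, ζ)
  /-- §4.3: decay of profiles. -/
  profile_decay : ∀ (y : Y) (ε : ℝ), 0 < ε → ∃ R : ℝ, ∀ q : ℝ × ℝ, 0 < q.1 → R ≤ ‖q‖ →
    |profile y q| < ε
  /-- Prop 4.4: `W = O(ρ²)` at the axis. -/
  stream_axis : ∀ (y : Y) (R : ℝ), ∃ C : ℝ, ∀ q : ℝ × ℝ, 0 < q.1 → q.1 ≤ 1 → |q.2| ≤ R →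
    |streamW (stream y) q| ≤ C * q.1 ^ 2
  /-- Prop 4.4: decay of `W`. -/
  stream_decay : ∀ (y : Y) (ε : ℝ), 0 < ε → ∃ R : ℝ, ∀ q : ℝ × ℝ, 0 < q.1 → R ≤ ‖q‖ →
    |streamW (stream y) q| < ε
  /-- The reconstructed field is smooth on `ℝ³` … -/
  field_smooth : ∀ y : Y, ContDiff ℝ ∞ (field y)
  /-- … and equals the reconstruction off the axis. -/
  field_eq : ∀ (y : Y) (x : EuclideanSpace ℝ (Fin 3)), cylRadius x ≠ 0 →
    field y x = reconstruct (profile y) (stream y) x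
  /-- The synthesis is injective on the physical half-plane (a basis). -/
  profile_inj : ∀ y : Y, (∀ q : ℝ × ℝ, 0 < q.1 → profile y q = 0) → y = 0

/-- **The printed enclosures in a framework** (the CAP package): Lemma 8.1 (8.1)
`‖𝒢(Ω̄_app,ν)‖_𝒳 ≤ δ`; Thm 9.2 «the linearized operator is non-singular and ‖D𝒢(Ω̄_app)⁻¹‖ ≤ M»;
Lemma 10.3 (10.x) `‖D𝒢(u) − D𝒢(v)‖_{𝓛(𝒴,𝒳)} ≤ K‖u − v‖_𝒴`; and `‖Ω̄_app‖ > 2Mδ` (App. A, p. 11: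
`Ω̂₁ = +5.000…`, so `‖Ω̄_app‖ ≥ 5·(1+1)³e^{0.08}` in either norm, while `2Mδ ≈ 8.1 × 10⁻⁹`).
[cite: Shahmurov2026b, Lemma 8.1 p.5, Thm 9.2 p.7, Lemma 10.3 p.8, App. A p.11] -/
structure Enclosures {ν : ℝ} {Y X : Type} [NormedAddCommGroup Y] [NormedSpace ℝ Y]
    [NormedAddCommGroup X] [NormedSpace ℝ X] (𝔉 : Framework ν Y X) : Prop where
  /-- `𝒢(·,ν)` is Fréchet differentiable («D𝒢», §9–§10). -/
  differentiable : Differentiable ℝ 𝔉.G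
  /-- Lemma 8.1 (8.1). -/
  residual : ‖𝔉.G 𝔉.Ωapp‖ ≤ residualDelta
  /-- Thm 9.2 (9.x): a bounded two-sided inverse of `D𝒢(Ω̄_app)` of norm `≤ M`. -/
  inverse : ∃ L : X →L[ℝ] Y,
    L.comp (fderiv ℝ 𝔉.G 𝔉.Ωapp) = ContinuousLinearMap.id ℝ Y ∧
      (fderiv ℝ 𝔉.G 𝔉.Ωapp).comp L = ContinuousLinearMap.id ℝ X ∧ ‖L‖ ≤ inverseBoundM
  /-- Lemma 10.3 (10.x). -/
  lipschitz : ∀ u v : Y, ‖fderiv ℝ 𝔉.G u - fderiv ℝ 𝔉.G v‖ ≤ lipschitzK * ‖u - v‖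
  /-- App. A: `‖Ω̄_app‖ > 2Mδ`. -/
  app_large : 2 * inverseBoundM * residualDelta < ‖𝔉.Ωapp‖

/-- **Step 2 (S-CAP, ONE step): for every `ν ∈ (0, ν_c)` there are Banach spaces `𝒴`, `𝒳` and an
analytic profile framework over them in which the printed enclosures `δ, M, K` hold.** (The closure
`2δMK < 1` of Cor 10.4 is arithmetic: `nk_closure`.) Typist's flag: not reproducible from print (no
ancillary code/data; App. E–F).
[cite: Shahmurov2026b, Lemma 8.1 p.5, Thm 9.2 p.7, Lemma 10.3 and Cor 10.4 p.8, Def 5.1 p.4, App. A–D pp.11–13] -/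
def Step_2 : Prop :=
  ∀ ν : ℝ, 0 < ν → ν < nuC →
    ∃ (Y X : Type) (_ : NormedAddCommGroup Y) (_ : NormedSpace ℝ Y) (_ : CompleteSpace Y)
      (_ : NormedAddCommGroup X) (_ : NormedSpace ℝ X) (_ : CompleteSpace X)
      (𝔉 : Framework ν Y X), Enclosures 𝔉

/-! ## Step 3 — S-PROFILE = Thm 11.1 (Newton–Kantorovich) -/

/-- **Step 3 (Thm 11.1, pp. 8–9): in any framework, the printed enclosures give an exact zero of
`𝒢(·,ν)` within `2Mδ` of `Ω̄_app`** («the Newton–Kantorovich theorem applies and yields a unique exact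
zero of 𝒢(·,ν) in the validated ball around Ω̄_app»; uniqueness is not used downstream and not typed).
Typist's flag: true — the classical Newton–Kantorovich theorem, whose hypothesis `2δM²K ≤ 1` holds
(`kantorovich_closure`). [cite: Shahmurov2026b, Thm 11.1 pp.8–9] -/
def Step_3 : Prop :=
  ∀ (ν : ℝ) (Y X : Type) [NormedAddCommGroup Y] [NormedSpace ℝ Y] [CompleteSpace Y]
    [NormedAddCommGroup X] [NormedSpace ℝ X] [CompleteSpace X] (𝔉 : Framework ν Y X),
    Enclosures 𝔉 → ∃ y : Y, 𝔉.G y = 0 ∧ ‖y - 𝔉.Ωapp‖ ≤ 2 * inverseBoundM * residualDelta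

/-- Support decl (NOT on the path; FAILURE-MODES F15): **the printed inference of Cor 10.4 read for
arbitrary constants** — «2δMK < 1. Hence the Newton–Kantorovich condition is satisfied» followed by
Thm 11.1: for ALL real Banach spaces, `C¹` maps and non-negative `δ', M', K'` with residual `≤ δ'`,
inverse bound `≤ M'`, Lipschitz constant `≤ K'` and `2δ'M'K' < 1`, a zero exists within `2M'δ'`.
Typist's flag: known-false pattern (Kantorovich needs `2δ'M'²K' ≤ 1`; 1-D quadratic countermodel);
its instance at the printed constants is `Step_3`, which survives. [cite: Shahmurov2026b, Cor 10.4 p.8 and Thm 11.1 proof pp.8–9] -/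
def CorNKInference : Prop :=
  ∀ (Y X : Type) [NormedAddCommGroup Y] [NormedSpace ℝ Y] [CompleteSpace Y]
    [NormedAddCommGroup X] [NormedSpace ℝ X] [CompleteSpace X]
    (G : Y → X) (x₀ : Y) (δ' M' K' : ℝ), 0 ≤ δ' → 0 ≤ M' → 0 ≤ K' →
    Differentiable ℝ G → ‖G x₀‖ ≤ δ' →
    (∃ L : X →L[ℝ] Y, L.comp (fderiv ℝ G x₀) = ContinuousLinearMap.id ℝ Y ∧
      (fderiv ℝ G x₀).comp L = ContinuousLinearMap.id ℝ X ∧ ‖L‖ ≤ M') →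
    (∀ u v : Y, ‖fderiv ℝ G u - fderiv ℝ G v‖ ≤ K' * ‖u - v‖) →
    2 * δ' * M' * K' < 1 →
      ∃ y : Y, G y = 0 ∧ ‖y - x₀‖ ≤ 2 * M' * δ'

/-- GLUE (proved): in a framework, a zero of `G` within `2Mδ` of `Ω̄_app`, `‖Ω̄_app‖ > 2Mδ`, realises to
an EXACT PROFILE — non-trivial because the zero is not `0 ∈ 𝒴` and the synthesis is injective on the
half-plane. [cite: Shahmurov2026b, Thm 11.1 pp.8–9] -/
theorem exactProfile_of_zero {ν : ℝ} {Y X : Type} [NormedAddCommGroup Y] [NormedSpace ℝ Y]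
    [NormedAddCommGroup X] [NormedSpace ℝ X] (𝔉 : Framework ν Y X) (hE : Enclosures 𝔉) {y : Y}
    (hy : 𝔉.G y = 0) (hball : ‖y - 𝔉.Ωapp‖ ≤ 2 * inverseBoundM * residualDelta) :
    IsExactProfile ν (𝔉.profile y) (𝔉.stream y) (𝔉.field y) := by
  have hy0 : y ≠ 0 := by
    intro h
    have h1 : ‖𝔉.Ωapp‖ ≤ 2 * inverseBoundM * residualDelta := by
      simpa [h, norm_neg] using hball
    exact (lt_irrefl _) (hE.app_large.trans_le h1)
  have hnt : ∃ q : ℝ × ℝ, 0 < q.1 ∧ 𝔉.profile y q ≠ 0 := by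
    by_contra hc
    push Not at hc
    exact hy0 (𝔉.profile_inj y hc)
  refine
    { pair := ?_
      odd := 𝔉.profile_odd y
      decay := 𝔉.profile_decay y
      stream_axis := 𝔉.stream_axis y
      stream_decay := 𝔉.stream_decay y
      field_smooth := 𝔉.field_smooth y
      field_eq := 𝔉.field_eq y
      nontrivial := hnt }
  exact
    { smooth_Ω := 𝔉.profile_smooth y
      smooth_ψ := 𝔉.stream_smooth y
      profile_eq := fun q hq => by
        have h := 𝔉.G_eq y q hq
        rw [hy, 𝔉.target_zero] at h
        exact h.symm
      recovery := 𝔉.recovery y }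

/-! ## Step 4 — S-RECON = Thm 12.1 (self-similar scaling of the vorticity; BKM divergence) -/

/-- **Step 4 (Thm 12.1, (12.1)–(12.4), p. 9): for an exact profile with reconstructed field `ū`,
vorticity `ω̄ = curl ū`, and every `T* > 0`, the self-similar field (12.2) has vorticity
`ω(x,t) = (T*−t)⁻¹ ω̄(x/√(T*−t))` (12.3), `‖ω(·,t)‖_{L^∞} = (T*−t)⁻¹‖ω̄‖_{L^∞}` (12.4) (suprema in
`[0, ∞]`, no junk), and `∫₀^{T*} ‖ω(·,t)‖_{L^∞} dt = ∞`** («By the Beale–Kato–Majda criterion, this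
corresponds to finite-time singularity formation»). Typist's flag: true (chain rule; divergence of
the integral needs `ω̄ ≢ 0`, which holds since the swirl `ρΩ̄` is `≢ 0` — implicit, true).
[cite: Shahmurov2026b, Thm 12.1 eqs. (12.1)–(12.4) p.9] -/
def Step_4 : Prop :=
  ∀ ν : ℝ, 0 < ν → ∀ T : ℝ, 0 < T →
    ∀ (Ω ψ : ℝ × ℝ → ℝ) (ubar : EuclideanSpace ℝ (Fin 3) → EuclideanSpace ℝ (Fin 3)),
      IsExactProfile ν Ω ψ ubar →
        (∀ t ∈ Ioo 0 T, ∀ x : EuclideanSpace ℝ (Fin 3),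
            curl (selfSimilar T ubar t) x = (T - t)⁻¹ • curl ubar ((Real.sqrt (T - t))⁻¹ • x)) ∧
        (∀ t ∈ Ioo 0 T,
            (⨆ x : EuclideanSpace ℝ (Fin 3), ‖curl (selfSimilar T ubar t) x‖ₑ) =
              ENNReal.ofReal ((T - t)⁻¹) * ⨆ x : EuclideanSpace ℝ (Fin 3), ‖curl ubar x‖ₑ) ∧
        (∫⁻ t in Ioo 0 T, ⨆ x : EuclideanSpace ℝ (Fin 3), ‖curl (selfSimilar T ubar t) x‖ₑ) = ⊤

/-! ## Step 5 — S-TORUS-DATA = Lemma 13.1 + Thm 13.2 (13.1), (i) -/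

/-- The lattice vector `2πn`, `n ∈ ℤ³`, of the torus `𝕋³ = ℝ³/2πℤ³` used in (13.1)
(«Σ_{n ∈ ℤ³} ū(x + 2πn)»). [cite: Shahmurov2026b, Lemma 13.1 proof and Thm 13.2 eq. (13.1) p.10] -/
def latticeVector (n : Fin 3 → ℤ) : EuclideanSpace ℝ (Fin 3) :=
  (2 * Real.pi) • (WithLp.toLp 2 fun i => (n i : ℝ) : EuclideanSpace ℝ (Fin 3))

/-- `2πℤ³`-periodicity of a field on `ℝ³` (the paper's `𝕋³`; compare the tree's `IsLatticePeriodic`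
= period `1`, Clay (8)/(10)). [cite: Shahmurov2026b, Thm 2.1 p.2 and Thm 13.2 eq. (13.1) p.10] -/
def IsTwoPiPeriodic {F : Type*} (v : EuclideanSpace ℝ (Fin 3) → F) : Prop :=
  ∀ (j : Fin 3) (x : EuclideanSpace ℝ (Fin 3)),
    v (x + (2 * Real.pi) • EuclideanSpace.single j (1 : ℝ)) = v x

/-- The raw periodic Poincaré sum `u_per(x) = Σ_{n ∈ ℤ³} ū(x + 2πn)` (Lemma 13.1, proof). Junk `0`
where the lattice sum does not converge — statements carry `Summable` explicitly.
[cite: Shahmurov2026b, Lemma 13.1 proof p.10] -/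
def periodisation (ubar : EuclideanSpace ℝ (Fin 3) → EuclideanSpace ℝ (Fin 3))
    (x : EuclideanSpace ℝ (Fin 3)) : EuclideanSpace ℝ (Fin 3) :=
  ∑' n : Fin 3 → ℤ, ubar (x + latticeVector n)

/-- **Step 5 (Lemma 13.1 + Thm 13.2 (13.1), (i), p. 10): for the profile `ū` of the construction,
the lattice sums `Σₙ ū(x + 2πn)` converge («the core is Gaussian-localized at scale σ = 0.05», l. 586)
and the exact periodic Leray projection `u₀ = 𝒫 Σₙ ū(· + 2πn)` is a `C^∞`, `2π`-periodic,
divergence-free field with `‖u₀ − Σₙ ū(· + 2πn)‖_{C^k} ≤ 10⁻²⁰` (typed: the `C⁰` instance).**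
Existential typing (the periodic Leray projector is not in the tree); (ii) `‖∇𝒲_p‖_{𝒳_𝕋³} ≤ 10⁻¹⁷¹⁴`
concerns the undefined torus norm and is not typed. Typist's flag: suspicious (no decay of `ū` is
printed; an exactly self-similar profile is not Gaussian-localized).
[cite: Shahmurov2026b, Lemma 13.1 and Thm 13.2 (13.1) (i) p.10] -/
def Step_5 : Prop :=
  ∀ ν : ℝ, 0 < ν →
    ∀ (Ω ψ : ℝ × ℝ → ℝ) (ubar : EuclideanSpace ℝ (Fin 3) → EuclideanSpace ℝ (Fin 3)),
    IsExactProfile ν Ω ψ ubar →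
      (∀ x : EuclideanSpace ℝ (Fin 3), Summable fun n : Fin 3 → ℤ => ubar (x + latticeVector n)) ∧
      ∃ u₀ : EuclideanSpace ℝ (Fin 3) → EuclideanSpace ℝ (Fin 3),
        ContDiff ℝ ∞ u₀ ∧ IsTwoPiPeriodic u₀ ∧ NSWave0.IsDivFree u₀ ∧
          ∀ x : EuclideanSpace ℝ (Fin 3), ‖u₀ x - periodisation ubar x‖ ≤ 1e-20

/-! ## Step 6 — S-PERSIST = Thm 13.2 (iii) + «Consequently, the singularity persists on 𝕋³» -/

/-- FINITE-TIME SINGULARITY ON `𝕋³` FROM THE DATUM `u₀` AT TIME `T` in the sense of Thm 2.1 / (2.2):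
a classical solution `(u, p)` of (2.1) (viscosity `ν`, no force) on `ℝ³ × [0, T)` with `u(0) = u₀`,
`u(·,t)` and `p(·,t)` `2π`-periodic («the periodic pressure», Lemma 13.1), and
`∫₀^{T} ‖∇u(·,t)‖_{L^∞} dt = ∞` (lower integral over `(0,T)` of the `[0,∞]`-valued supremum of the
operator norm of `∇u`). [cite: Shahmurov2026b, Thm 2.1 eq. (2.2) p.2 and Thm 13.2 p.10] -/
def TorusBlowupFrom (ν : ℝ) (u₀ : EuclideanSpace ℝ (Fin 3) → EuclideanSpace ℝ (Fin 3)) (T : ℝ) :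
    Prop :=
  ∃ (u : ℝ → EuclideanSpace ℝ (Fin 3) → EuclideanSpace ℝ (Fin 3))
    (p : ℝ → EuclideanSpace ℝ (Fin 3) → ℝ),
    IsClassicalNSSolutionOn (Ico 0 T) ν 0 u p ∧ u 0 = u₀ ∧
      (∀ t ∈ Ico 0 T, IsTwoPiPeriodic (u t) ∧ IsTwoPiPeriodic (p t)) ∧
      (∫⁻ t in Ioo 0 T, ⨆ x : EuclideanSpace ℝ (Fin 3), ‖fderiv ℝ (u t) x‖ₑ) = ⊤

/-- **Step 6 (Thm 13.2 (iii) and its last sentence, pp. 10–11, l. 620–640; used in §14, l. 645):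
«the total torus transfer error ε_𝕋³ satisfies 2(δ + ε_𝕋³)MK < 1. Consequently, the singularity
persists on 𝕋³» — proof: «Thus the Newton–Kantorovich certificate survives the torus transfer, and the
singularity persists on the periodic domain».** Typed as the implication the headline consumes: for an
exact profile with field `ū` whose self-similar evolution (12.2) is a classical Navier–Stokes solution
on `ℝ³ × (0,T*)` with `∫₀^{T*}‖ω‖_∞ = ∞` (outputs of Steps 1, 4), a datum `u₀` as in Step 5, and the
inequality (iii), the periodic Cauchy problem from `u₀` exhibits `TorusBlowupFrom ν u₀ T'` at some
`T' > 0`. Typist's flag: suspicious (an inequality for a perturbed STATIONARY equation is asserted to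
control the EVOLUTION from `u₀`; no stability theorem for the flow is printed).
[cite: Shahmurov2026b, Thm 13.2 (iii) pp.10–11 and §14 p.11] -/
def Step_6 : Prop :=
  ∀ ν : ℝ, 0 < ν → ∀ T : ℝ, 0 < T →
    ∀ (Ω ψ : ℝ × ℝ → ℝ) (ubar u₀ : EuclideanSpace ℝ (Fin 3) → EuclideanSpace ℝ (Fin 3)),
      IsExactProfile ν Ω ψ ubar →
      (∃ p : ℝ → EuclideanSpace ℝ (Fin 3) → ℝ,
          IsClassicalNSSolutionOn (Ioo 0 T) ν 0 (selfSimilar T ubar) p) →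
      (∫⁻ t in Ioo 0 T, ⨆ x : EuclideanSpace ℝ (Fin 3), ‖curl (selfSimilar T ubar t) x‖ₑ) = ⊤ →
      ContDiff ℝ ∞ u₀ → IsTwoPiPeriodic u₀ → NSWave0.IsDivFree u₀ →
      (∀ x : EuclideanSpace ℝ (Fin 3), ‖u₀ x - periodisation ubar x‖ ≤ 1e-20) →
      2 * (residualDelta + torusEps) * inverseBoundM * lipschitzK < 1 →
        ∃ T' : ℝ, 0 < T' ∧ TorusBlowupFrom ν u₀ T'

/-! ## The claimed theorem (Thm 2.1) and the composition (§14) -/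

/-- A period cell `[0, 2π]³` of `𝕋³ = ℝ³/2πℤ³` (the domain of «∫_{𝕋³} |u₀|² dx»).
[cite: Shahmurov2026b, Thm 2.1 p.2] -/
def periodCell : Set (EuclideanSpace ℝ (Fin 3)) :=
  {x | ∀ i : Fin 3, x i ∈ Icc 0 (2 * Real.pi)}

/-- **THE CLAIMED THEOREM (Thm 2.1, p. 2), typed core**: for every `ν ∈ (0, ν_c)` there is a `C^∞`,
divergence-free, `2π`-periodic `u₀` on `ℝ³` with `∫_{[0,2π]³} |u₀|² < ∞` whose periodic-pressure
classical solution develops a singularity at some finite `T*` in the sense (2.2)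
(`TorusBlowupFrom`). The informal rider «asymptotically nearly self-similar and stable in 𝒳» is not
typed (no printed definition). [cite: Shahmurov2026b, Thm 2.1 eqs. (2.1)–(2.2) p.2] -/
def ClaimedTheorem : Prop :=
  ∀ ν : ℝ, 0 < ν → ν < nuC →
    ∃ u₀ : EuclideanSpace ℝ (Fin 3) → EuclideanSpace ℝ (Fin 3),
      ContDiff ℝ ∞ u₀ ∧ NSWave0.IsDivFree u₀ ∧ IsTwoPiPeriodic u₀ ∧
        IntegrableOn (fun x => ‖u₀ x‖ ^ 2) periodCell ∧
        ∃ T : ℝ, 0 < T ∧ TorusBlowupFrom ν u₀ T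

/-- The period cell is compact (preimage of `[0,2π]³ ⊆ ℝ³` under the coordinate map).
[cite: Shahmurov2026b, Thm 2.1 p.2] -/
theorem isCompact_periodCell : IsCompact periodCell := by
  have h : periodCell =
      (EuclideanSpace.equiv (Fin 3) ℝ) ⁻¹' Set.pi Set.univ (fun _ => Icc 0 (2 * Real.pi)) := by
    ext x
    simp only [periodCell, mem_setOf_eq, mem_preimage, Set.mem_pi, Set.mem_univ, true_implies]
    rfl
  rw [h]
  exact ((EuclideanSpace.equiv (Fin 3) ℝ).toHomeomorph.isCompact_preimage).mpr
    (isCompact_univ_pi fun _ => isCompact_Icc)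

/-- The printed energy clause «∫_{𝕋³}|u₀|² dx < ∞» is automatic for a `C^∞` (hence continuous) field
on the compact period cell — used in the composition. [cite: Shahmurov2026b, Thm 2.1 p.2] -/
theorem integrableOn_periodCell {u₀ : EuclideanSpace ℝ (Fin 3) → EuclideanSpace ℝ (Fin 3)}
    (hu₀ : ContDiff ℝ ∞ u₀) : IntegrableOn (fun x => ‖u₀ x‖ ^ 2) periodCell :=
  ((hu₀.continuous.norm).pow 2).continuousOn.integrableOn_compact isCompact_periodCell

/-- **COMPOSITION from the charitable Step 1′** (§14, p. 11: Thm 11.1 ∘ Thm 12.1 ∘ Thm 13.2):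
`Step_1' → Step_2 → Step_3 → Step_4 → Step_5 → Step_6 → ClaimedTheorem`. Pure logic on the typed
steps (with `T* = 1`), the glue `exactProfile_of_zero`, the arithmetic `torus_closure` and the energy
lemma `integrableOn_periodCell`. [cite: Shahmurov2026b, §14 proof of Thm 2.1 p.11] -/
theorem claim_of_steps' (h1 : Step_1') (h2 : Step_2) (h3 : Step_3) (h4 : Step_4) (h5 : Step_5)
    (h6 : Step_6) : ClaimedTheorem := by
  intro ν hν hνc
  obtain ⟨Y, X, _, _, _, _, _, _, 𝔉, hE⟩ := h2 ν hν hνc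
  obtain ⟨y, hy, hball⟩ := h3 ν Y X 𝔉 hE
  have hP : IsExactProfile ν (𝔉.profile y) (𝔉.stream y) (𝔉.field y) :=
    exactProfile_of_zero 𝔉 hE hy hball
  obtain ⟨p, hNS⟩ := h1 ν hν 1 one_pos _ _ _ hP
  have hBKM := (h4 ν hν 1 one_pos _ _ _ hP).2.2
  obtain ⟨-, u₀, hu₀, hper, hdiv, hclose⟩ := h5 ν hν _ _ _ hP
  obtain ⟨T', hT', hblow⟩ :=
    h6 ν hν 1 one_pos _ _ _ u₀ hP ⟨p, hNS⟩ hBKM hu₀ hper hdiv hclose torus_closure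
  exact ⟨u₀, hu₀, hdiv, hper, integrableOn_periodCell hu₀, T', hT', hblow⟩

/-- **COMPOSITION (§14, p. 11)**: `Step_1 → Step_2 → Step_3 → Step_4 → Step_5 → Step_6 →
ClaimedTheorem` — the paper's logic composes AS TYPED. [cite: Shahmurov2026b, §14 proof of Thm 2.1 p.11] -/
theorem claim_of_steps (h1 : Step_1) (h2 : Step_2) (h3 : Step_3) (h4 : Step_4) (h5 : Step_5)
    (h6 : Step_6) : ClaimedTheorem :=
  claim_of_steps' (step1'_of_step1 h1) h2 h3 h4 h5 h6

/-! ## Clay link: the typed delta to printed (D) (TYPING-HYGIENE §10 (b)) -/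

/-- A GLOBAL smooth solution from `u₀` in the PRINTED periodic class at period `2π`: `v`, `q` smooth on
`ℝ³ × [0,∞)`, solving (1)(2)(3) with viscosity `ν`, no force, datum `u₀`, and `v(·,t)` `2π`-periodic
for `t ≥ 0` — pressure unconstrained, exactly as Clay (10) (the `2π`-twin of
`ClayVariants.clayPeriodic.Solvable ν 0 u₀`). [cite: FeffermanClay2006, statement (B) with (10) (11) p.2] -/
def HasGlobalPrintedSolution (ν : ℝ) (u₀ : EuclideanSpace ℝ (Fin 3) → EuclideanSpace ℝ (Fin 3)) :
    Prop :=
  ∃ (v : ℝ → EuclideanSpace ℝ (Fin 3) → EuclideanSpace ℝ (Fin 3))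
    (q : ℝ → EuclideanSpace ℝ (Fin 3) → ℝ),
    IsSmoothOnHalfSpace v ∧ IsSmoothOnHalfSpace q ∧ IsNavierStokesSolution ν 0 u₀ v q ∧
      ∀ t : ℝ, 0 ≤ t → IsTwoPiPeriodic (v t)

/-- CLASSICAL BRIDGE 1 (Δ5/Δ6, «the unique solution … develops a finite-time singularity»): a
periodic-pressure classical solution on `[0,T)` with `∫₀^T ‖∇u‖_∞ = ∞` from `u₀` EXCLUDES every global
smooth solution of the printed class from the same datum (uniqueness of smooth periodic solutions up
to the Galilean frame freedom `u ↦ u(x + ξ(t), t) − ξ′(t)`, which leaves `‖∇u(t)‖_∞` unchanged; cf. the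
docstring of `NSWave0.lean` and Tao 2013, Prop. 1.7). Standard, NOT in the tree; part of `ClayDelta`.
[cite: Tao2013Localisation, Prop. 1.7 and §2] -/
def ContinuationBridge : Prop :=
  ∀ ν : ℝ, 0 < ν →
    ∀ (u₀ : EuclideanSpace ℝ (Fin 3) → EuclideanSpace ℝ (Fin 3)) (T : ℝ), 0 < T →
      TorusBlowupFrom ν u₀ T → ¬ HasGlobalPrintedSolution ν u₀

/-- CLASSICAL BRIDGE 2 (Δ1, period `2π` vs Clay's period `1`): an unforced smooth `2π`-periodic datum
with no global printed-class solution at viscosity `ν` refutes Clay-(B)-regularity at the SAME `ν`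
(parabolic scaling `v(t,x) = 2π·u((2π)²t, 2πx)` keeps `ν`; «EQUIVALENT», Tao 2013 Rem. 1.2). The
scaling of classical periodic solutions is not in `Literature/`; part of `ClayDelta`.
[cite: Tao2013Localisation, Rem. 1.2] -/
def PeriodScalingBridge : Prop :=
  ∀ ν : ℝ, 0 < ν →
    (∃ u₀ : EuclideanSpace ℝ (Fin 3) → EuclideanSpace ℝ (Fin 3),
        ContDiff ℝ ∞ u₀ ∧ NSWave0.IsDivFree u₀ ∧ IsTwoPiPeriodic u₀ ∧
          ¬ HasGlobalPrintedSolution ν u₀) →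
      ¬ ClayVariants.clayPeriodic.RegularityAt ν

/-- **THE TYPED CLAY DELTA**: the exact extra hypothesis under which the claimed theorem yields Clay's
printed (D) — the conjunction of the two classical bridges (no «wrong problem» axis: both are
EQUIVALENT-type bookkeeping in the sense of `ClayVariants` §3, absent from the tree).
[cite: FeffermanClay2006, statement (D) p.2] -/
def ClayDelta : Prop :=
  ContinuationBridge ∧ PeriodScalingBridge

/-- **`ClayDelta → ClaimedTheorem → Clay (D) (printed)`**, PROVED: at `ν = ν_c/2` the claimed datum has
no global printed-class solution (bridge 1), so `clayPeriodic.RegularityAt (ν_c/2)` fails (bridge 2),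
and ONE unforced periodic counterexample gives (D) at every viscosity
(`ClayVariants.navierStokesBreakdownPeriodic_of_not_regularityAt`, Δ7 in tree).
[cite: FeffermanClay2006, statement (D) p.2] -/
theorem clay_of_claimed_of_delta (hΔ : ClayDelta) (h : ClaimedTheorem) :
    ClayVariants.clayPeriodic.Breakdown := by
  have hν : 0 < nuC / 2 := by norm_num [nuC]
  have hνc : nuC / 2 < nuC := by norm_num [nuC]
  obtain ⟨u₀, hu₀, hdiv, hper, -, T, hT, hblow⟩ := h (nuC / 2) hν hνc
  have hno : ¬ HasGlobalPrintedSolution (nuC / 2) u₀ := hΔ.1 _ hν u₀ T hT hblow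
  have hnreg : ¬ ClayVariants.clayPeriodic.RegularityAt (nuC / 2) :=
    hΔ.2 _ hν ⟨u₀, hu₀, hdiv, hper, hno⟩
  exact ClayVariants.clayPeriodic_breakdown_iff.mpr
    (ClayVariants.navierStokesBreakdownPeriodic_of_not_regularityAt hν hnreg)

/-- Hence also the CMI-errata form of (D) (`ClayVariants.clayPeriodic_breakdown_imp_errata`).
[cite: FeffermanClay2006, statement (D) p.2 and errata p.6] -/
theorem clayDErrata_of_claimed_of_delta (hΔ : ClayDelta) (h : ClaimedTheorem) :
    ClayVariants.clayPeriodicErrata.Breakdown :=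
  ClayVariants.clayPeriodic_breakdown_imp_errata (clay_of_claimed_of_delta hΔ h)

/-! ## Support decl: (3.3) as printed, for axisymmetric Navier–Stokes velocities (forward direction) -/

/-- Support decl (NOT on the path; erratum column): **eq. (3.3), p. 2, as printed** — «The meridional
drift satisfies the 5D incompressibility condition ∂ᵣu^r + (3/r)u^r + ∂_zu^z = 0» — asserted for the
drift `b = (u^r, u^z)` of the (axisymmetric, divergence-free) velocity `u` of Def 3.1. Typed: for every
`C^∞` axisymmetric divergence-free `u` on `ℝ³`, with meridian profiles `u^r(r,z)`, `u^z(r,z)` read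
off on the meridian half-plane `(r, 0, z)` via the tree's `radialVelocity`/`axialVelocity`, the
identity holds at every `r > 0`. Typist's flag: known-false pattern (`div u = ∂ᵣu^r + u^r/r + ∂_zu^z`
for axisymmetric fields, so (3.3) forces `u^r ≡ 0`). [cite: Shahmurov2026b, eq. (3.3) p.2] -/
def LiftedIncompressibility : Prop :=
  ∀ u : EuclideanSpace ℝ (Fin 3) → EuclideanSpace ℝ (Fin 3),
    ContDiff ℝ ∞ u → IsAxisymmetric u → NSWave0.IsDivFree u →
      ∀ q : ℝ × ℝ, 0 < q.1 →
        derivR (fun q' => radialVelocity u (meridianPoint q')) q +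
            3 / q.1 * radialVelocity u (meridianPoint q) +
          derivZ (fun q' => axialVelocity u (meridianPoint q')) q = 0

/-! ## The typed Clay delta is a theorem (Literature-side discharge)

Twin, with Literature tools only, of the summit tree's
`Summit.NavierStokesRegularity.NavierStokesRegularity.Theorems.Shahmurov2026b.clayDelta_holds`
(`Theorems/SoloSalvageShahmurov2026bClayDelta.lean`, salvage lane; Summits files are not importable into
`Literature/`), recorded here so that the named facts `ContinuationBridge`, `PeriodScalingBridge`,
`ClayDelta` are discharged where they are declared. Route for the continuation half: Leray rescaling
`u ↦ 2π·u((2π)²t, 2πx)` to period `1` at the same `ν` (`IsClassicalNSSolutionOn.nsRescale_holds`,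
`ClayVariants.clayPeriodic_solvable_nsRescaleData_iff`), the blow-up `∫₀ᵀ ‖∇u‖_∞ = ∞` read as «`‖∇u‖`
is unbounded on `[0,T) × ℝ³`» (a bounded integrand on an interval of finite length has finite integral),
and the reference seat's periodic GRADIENT sup-norm certificate
`ClayVariants.not_clayPeriodic_solvable_of_gradientSupCertificate` (Galilean renormalisation of the
pressure + classical uniqueness on `𝕋³` + compactness, file `ClayPeriodicSupBlowupCertificate`). -/

section ClayDeltaDischarge

/-- The unforced system is scale invariant: `nsRescaleForce c 0 = 0`. [cite: Leray1934, §20] -/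
private theorem nsRescaleForce_zero (c : ℝ) :
    nsRescaleForce c (0 : ℝ → EuclideanSpace ℝ (Fin 3) → EuclideanSpace ℝ (Fin 3)) = 0 := by
  funext t x
  simp [nsRescaleForce_apply]

/-- Time rescaling of a half-open slab: `(c² ·)⁻¹' [0, T) = [0, T / c²)` for `c ≠ 0`. [folklore] -/
private theorem preimage_sq_mul_Ico {c : ℝ} (hc : 0 < c) (T : ℝ) :
    (fun t : ℝ => c ^ 2 * t) ⁻¹' Ico 0 T = Ico 0 (T / c ^ 2) := by
  have hc2 : 0 < c ^ 2 := by positivity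
  ext t
  simp only [mem_preimage, mem_Ico]
  rw [lt_div_iff₀ hc2, mul_comm t, mul_nonneg_iff_of_pos_left hc2]

/-- **A blow-up of `∫₀ᵀ ‖∇u‖_∞` forces `‖∇u‖` to be unbounded on `[0,T) × ℝ³`**: if
`‖∇u(t, x)‖ ≤ M` there, the integrand is at most `M` on `(0, T)`, an interval of length `T < ∞`.
[cite: BealeKatoMajda1984, §1] -/
theorem gradient_unbounded_of_lintegral_eq_top {u : ℝ → EuclideanSpace ℝ (Fin 3) → EuclideanSpace ℝ (Fin 3)}
    {T : ℝ}
    (hblow : (∫⁻ t in Ioo 0 T, ⨆ x : EuclideanSpace ℝ (Fin 3), ‖fderiv ℝ (u t) x‖ₑ) = ⊤) :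
    ∀ M : ℝ, ∃ t ∈ Ico 0 T, ∃ x : EuclideanSpace ℝ (Fin 3), M < ‖fderiv ℝ (u t) x‖ := by
  by_contra h
  simp only [not_forall, not_exists, not_and, not_lt] at h
  obtain ⟨M, hM⟩ := h
  have hle : (∫⁻ t in Ioo 0 T, ⨆ x : EuclideanSpace ℝ (Fin 3), ‖fderiv ℝ (u t) x‖ₑ) ≤
      ∫⁻ _ in Ioo 0 T, ENNReal.ofReal M :=
    setLIntegral_mono measurable_const fun t ht =>
      iSup_le fun x => by
        rw [← ofReal_norm]
        exact ENNReal.ofReal_le_ofReal (hM t ⟨ht.1.le, ht.2⟩ x)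
  rw [setLIntegral_const, Real.volume_Ioo, hblow, top_le_iff] at hle
  exact ENNReal.mul_ne_top ENNReal.ofReal_ne_top ENNReal.ofReal_ne_top hle

/-- **`ContinuationBridge` is a THEOREM.** A periodic-pressure classical solution on `[0,T)` from `u₀`
with `∫₀ᵀ ‖∇u‖_∞ = ∞` excludes every global solution of the printed class (smooth on `ℝ³ × [0,∞)`,
velocity `2π`-periodic, pressure free) from `u₀`: rescale both to period `1` (Leray, same `ν`); the
global one becomes a Clay-(B)-class solution from `2π·u₀(2π·)`, the local one a periodic-pressure
classical solution from the same datum with `‖∇·‖` unbounded on `[0, T/(2π)²) × ℝ³` — impossible by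
`ClayVariants.not_clayPeriodic_solvable_of_gradientSupCertificate`. Literature-side twin of
`Summit.….Theorems.Shahmurov2026b.continuationBridge_holds`. [cite: Tao2013Localisation, Prop. 1.7 and §2]
[cite: FeffermanClay2006, (B) (D) with (8) (10) (11) p. 2] -/
theorem continuationBridge_holds : ContinuationBridge := by
  intro ν hν u₀ T hT hblowup hglob
  obtain ⟨u, p, hcl, hu0, hper, hblow⟩ := hblowup
  set L : ℝ := 2 * Real.pi with hLdef
  have hL : 0 < L := Real.two_pi_pos
  have hL2 : 0 < L ^ 2 := by positivity
  -- the global printed-class solution, rescaled to period 1, is a Clay-(B)-class solution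
  have hsol : ClayVariants.clayPeriodic.Solvable ν 0 (nsRescaleData L u₀) := by
    obtain ⟨v, q, hv, hq, hns, hvper⟩ := hglob
    exact (ClayVariants.clayPeriodic_solvable_nsRescaleData_iff hL ν u₀).mpr ⟨v, q, hv, hq, hns, hvper⟩
  -- the blow-up solution, rescaled to period 1
  have hcl' : IsClassicalNSSolutionOn (Ico 0 (T / L ^ 2)) ν 0 (nsRescale L u) (nsRescalePressure L p) := by
    have h := IsClassicalNSSolutionOn.nsRescale_holds hcl hL
    rwa [nsRescaleForce_zero, preimage_sq_mul_Ico hL] at h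
  have hu0' : nsRescale L u 0 = nsRescaleData L u₀ := by
    funext x
    simp [nsRescale_apply, nsRescaleData_apply, hu0]
  have hmem : ∀ t ∈ Ico 0 (T / L ^ 2), L ^ 2 * t ∈ Ico 0 T := fun t ht =>
    ⟨mul_nonneg hL2.le ht.1, by rw [mul_comm]; exact (lt_div_iff₀ hL2).1 ht.2⟩
  have hper' : ∀ t ∈ Ico 0 (T / L ^ 2),
      IsLatticePeriodic (nsRescale L u t) ∧ IsLatticePeriodic (nsRescalePressure L p t) := by
    intro t ht
    obtain ⟨hu_t, hp_t⟩ := hper (L ^ 2 * t) (hmem t ht)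
    refine ⟨?_, ?_⟩
    · have h : nsRescale L u t = fun x => L • u (L ^ 2 * t) (L • x) := funext fun x => rfl
      rw [h]
      exact ClayVariants.isLatticePeriodic_smul_comp_smul hu_t L
    · have h : nsRescalePressure L p t = fun x => (L ^ 2) • p (L ^ 2 * t) (L • x) :=
        funext fun x => by simp [nsRescalePressure_apply]
      rw [h]
      exact ClayVariants.isLatticePeriodic_smul_comp_smul hp_t (L ^ 2)
  -- the gradient of the rescaled velocity is unbounded on the rescaled slab
  have hunb := gradient_unbounded_of_lintegral_eq_top hblow
  have hblow' : ∀ M : ℝ, ∃ t ∈ Ico 0 (T / L ^ 2), ∃ x : EuclideanSpace ℝ (Fin 3),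
      M < ‖fderiv ℝ (nsRescale L u t) x‖ := by
    intro M
    obtain ⟨t, ht, x, hM⟩ := hunb (M / L ^ 2)
    refine ⟨t / L ^ 2, ⟨div_nonneg ht.1 hL2.le, div_lt_div_of_pos_right ht.2 hL2⟩, L⁻¹ • x, ?_⟩
    have hslice : nsRescale L u (t / L ^ 2) = L • fun z => u t (L • z) := by
      funext y
      simp [nsRescale_apply, mul_div_cancel₀ t hL2.ne']
    have hdiff : Differentiable ℝ (fun z => u t (L • z)) :=
      ((hcl.contDiff_velocity ht).differentiable (by simp)).comp (differentiable_id.const_smul L)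
    rw [hslice, fderiv_const_smul (hdiff _) L, fderiv_comp_smul, smul_inv_smul₀ hL.ne', smul_smul,
      norm_smul, Real.norm_eq_abs, abs_of_pos (mul_pos hL hL), ← sq]
    rwa [div_lt_iff₀ hL2, mul_comm] at hM
  exact ClayVariants.not_clayPeriodic_solvable_of_gradientSupCertificate hν.le hcl' hu0' hper' hblow' hsol

/-- `ContinuationBridge` — `_holds` alias of `continuationBridge_holds` above under the fact's exact name (appended
2026-08-28, D-0026 bookkeeping: the proof term is the existing theorem of this file; no statement,
definition or attribute is edited; no new named fact; the ledger's debt table listed the fact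
unproved). [cite: FeffermanClay2006, (B) (D) with (8) (10) (11) p. 2] -/
theorem _root_.Literature.Claims.NS.Shahmurov2026b.ContinuationBridge_holds : ContinuationBridge :=
  _root_.Literature.Claims.NS.Shahmurov2026b.continuationBridge_holds

/-- **`PeriodScalingBridge` is a THEOREM** (the reference seat's `ClayVariants.not_clayPeriodic_regularityAt_of_period`
at `L = 2π`; twin of `Summit.….Theorems.Shahmurov2026b.periodScalingBridge_holds`).
[cite: Tao2013Localisation, Rem. 1.2] [cite: FeffermanClay2006, (B) with (8) (10), p. 2] -/
theorem periodScalingBridge_holds : PeriodScalingBridge := by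
  intro ν _hν h
  obtain ⟨u₀, hu₀, hdiv, hper, hno⟩ := h
  exact ClayVariants.not_clayPeriodic_regularityAt_of_period Real.two_pi_pos hu₀ hdiv hper hno

/-- **The typed Clay delta holds** (twin of `Summit.….Theorems.Shahmurov2026b.clayDelta_holds`).
[cite: FeffermanClay2006, statement (D) p.2] -/
theorem clayDelta_holds : ClayDelta := ⟨continuationBridge_holds, periodScalingBridge_holds⟩

/-- **The Clay link, unconditional**: the claimed Theorem 2.1 decides Clay (D) AS PRINTED
(`clay_of_claimed_of_delta` fed with `clayDelta_holds`; twin of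
`Summit.….Theorems.Shahmurov2026b.clayD_of_claimed`). [claim: Shahmurov2026b, status: disputed] -/
theorem clay_of_claimed (h : ClaimedTheorem) : ClayVariants.clayPeriodic.Breakdown :=
  clay_of_claimed_of_delta clayDelta_holds h

/-- … and the CMI-errata form of (D). [cite: FeffermanClay2006, statement (D) p.2 and errata p.6] -/
theorem clayDErrata_of_claimed (h : ClaimedTheorem) : ClayVariants.clayPeriodicErrata.Breakdown :=
  clayDErrata_of_claimed_of_delta clayDelta_holds h

end ClayDeltaDischarge

end Literature.Claims.NS.Shahmurov2026b

end
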